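import Mathlib.Geometry.Manifold.PartitionOfUnity
import Mathlib.Analysis.Normed.Lp.SmoothApprox
import Mathlib.Topology.MetricSpace.Thickening
import Literature.Analysis.FunctionSpaces.SobolevDomain
import HarnessLib

/-!
# Test functions on an open set are dense in `L^p` of that open set

Analysis/FunctionSpaces support file (serves the lower semicontinuity of the dissipation
`E(Q') = r⁻¹ ∫_{Q'} |∇u|²` under weak limits in the Albritton–Barker Type I theory,
`FluidPDE/LocalTypeI*`; the statement is the textbook density theorem).

Let `X` be a finite-dimensional real normed space with its Borel σ-algebra, `μ` a measure on `X`
finite on compact sets, `S ⊆ X` open, `1 ≤ p < ∞`. We prove (Adams, *Sobolev Spaces* (1975),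
Cor. 2.19 / Adams–Fournier 2003, Cor. 2.30: "`C₀^∞(Ω)` is dense in `L^p(Ω)` if `1 ≤ p < ∞`";
Brezis, *Functional Analysis*, Cor. 4.23):

* `exists_smooth_cutoff_mem_Icc`: smooth Urysohn with values in `[0, 1]` — for compact `K`
  inside open `U` there is `χ ∈ C_c^∞(U)`, `0 ≤ χ ≤ 1`, `χ = 1` on `K` (Mathlib's manifold
  version `exists_contMDiffMap_zero_one_of_isClosed` on the model space);
* `exists_isCompact_eLpNorm_sub_indicator_le`: for `f ∈ L^p(S, μ)` and `ε > 0` a compact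
  `K ⊆ S` with `‖f - 𝟙_K f‖_{L^p(S)} ≤ ε` (exhaustion of `S` by the compact sets
  `{‖x‖ ≤ n} ∩ {dist(x, Sᶜ) ≥ 1/(n+1)}` and dominated convergence);
* `exists_isTestFunctionOn_eLpNorm_sub_le`, `exists_isTestFunctionOn_tendsto_eLpNorm_sub`:
  for `f ∈ L^p(S, μ)` there are test functions `φ ∈ C_c^∞(S)` (`Literature.IsTestFunctionOn S φ`)
  with `‖f - φ‖_{L^p(S, μ)}` arbitrarily small, resp. a sequence with `‖f - φₙ‖_{L^p(S)} → 0`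
  (truncate to `K`, approximate `𝟙_K f` on the whole space by a smooth compactly supported `g`
  — Mathlib `MeasureTheory.MemLp.exist_eLpNorm_sub_le` — and multiply by the cut-off:
  `‖𝟙_K f - χ g‖_p = ‖χ (𝟙_K f - g)‖_p ≤ ‖𝟙_K f - g‖_p`).

## Mathlib search

Mathlib (this pin) has the density of `C_c^∞(X)` in `L^p(X, μ)` on the *whole* space
(`MeasureTheory.MemLp.exist_eLpNorm_sub_le`, `Lp.dense_hasCompactSupport_contDiff`) and smooth
Urysohn functions on manifolds (`exists_contMDiffMap_zero_one_of_isClosed`), but not the version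
with supports inside a prescribed open set (searched `dense`, `exist_eLpNorm`, `tsupport` in
`Analysis/Normed/Lp`, `MeasureTheory/Function`, `Analysis/Distribution`). The tree's
`MeyersSerrinProofs.exists_smooth_cutoff` has no range control and a heavy import closure; the
cut-off is re-derived here with `0 ≤ χ ≤ 1`.

## References

* R. A. Adams, *Sobolev Spaces* (1975), Lemma 2.18, Cor. 2.19; R. A. Adams, J. J. F. Fournier,
  *Sobolev Spaces*, 2nd ed. (2003), Thm. 2.29, Cor. 2.30.
* H. Brezis, *Functional Analysis, Sobolev Spaces and PDE* (2011), Cor. 4.23.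
-/

noncomputable section

open MeasureTheory TopologicalSpace Set Function Filter Topology Metric
open scoped ENNReal NNReal Manifold

namespace Literature.Analysis.FunctionSpaces

variable {X : Type*} [NormedAddCommGroup X] [NormedSpace ℝ X] [FiniteDimensional ℝ X]

/-! ### Smooth cut-offs with values in `[0, 1]` -/

/-- **Smooth Urysohn lemma with range in `[0, 1]`.** For a compact `K` inside an open `U` of a
finite-dimensional real normed space there is `χ ∈ C_c^∞(U)` with `0 ≤ χ ≤ 1` everywhere and
`χ = 1` on `K` (Mathlib's `exists_contMDiffMap_zero_one_of_isClosed` on the model space, applied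
to the closed sets `(K_δ)ᶜ` and `K` for an open `δ`-neighbourhood `K_δ` of `K` with
`K̄_δ ⊆ U`). [folklore] -/
theorem exists_smooth_cutoff_mem_Icc {K U : Set X} (hK : IsCompact K) (hU : IsOpen U)
    (hKU : K ⊆ U) :
    ∃ χ : X → ℝ, ContDiff ℝ (⊤ : ℕ∞) χ ∧ HasCompactSupport χ ∧ tsupport χ ⊆ U ∧
      (∀ x ∈ K, χ x = 1) ∧ ∀ x, χ x ∈ Icc (0 : ℝ) 1 := by
  obtain ⟨δ, hδ, hδU⟩ := hK.exists_cthickening_subset_open hU hKU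
  have hd : Disjoint (thickening δ K)ᶜ K :=
    disjoint_compl_left.mono_right (self_subset_thickening hδ K)
  obtain ⟨f, hf0, hf1, hf01⟩ :=
    exists_contMDiffMap_zero_one_of_isClosed (𝓘(ℝ, X)) (n := (⊤ : ℕ∞))
      isOpen_thickening.isClosed_compl hK.isClosed hd
  have hsupp : support (f : X → ℝ) ⊆ thickening δ K := fun x hx => by
    by_contra hx'
    exact hx (by simpa using hf0 hx')
  have htsupp : tsupport (f : X → ℝ) ⊆ cthickening δ K :=
    (closure_mono hsupp).trans (closure_thickening_subset_cthickening δ K)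
  exact ⟨f, contMDiff_iff_contDiff.1 f.contMDiff,
    hK.cthickening.of_isClosed_subset (isClosed_tsupport _) htsupp, htsupp.trans hδU,
    fun x hx => by simpa using hf1 hx, hf01⟩

/-! ### Exhaustion of an open set and truncation in `L^p` -/

omit [NormedAddCommGroup X] [NormedSpace ℝ X] [FiniteDimensional ℝ X] in
/-- `(n + 1)⁻¹ → 0` in `ℝ≥0∞`. [folklore] -/
theorem tendsto_inv_natCast_add_one :
    Tendsto (fun n : ℕ => ((n : ℝ≥0∞) + 1)⁻¹) atTop (𝓝 0) := by
  have := ENNReal.tendsto_inv_nat_nhds_zero.comp (tendsto_add_atTop_nat 1)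
  refine this.congr fun n => ?_
  simp only [comp_apply, Nat.cast_add, Nat.cast_one]

/-- The compact exhaustion `Kₙ = {‖x‖ ≤ n} ∩ {infEdist(x, Sᶜ) ≥ 1/(n+1)}` of an open set `S`:
compact subsets of `S`, and every point of `S` lies in `Kₙ` for all large `n`. [folklore] -/
theorem exists_compact_exhaustion (S : Opens X) :
    ∃ K : ℕ → Set X, (∀ n, IsCompact (K n)) ∧ (∀ n, IsClosed (K n)) ∧
      (∀ n, K n ⊆ (S : Set X)) ∧ ∀ x ∈ (S : Set X), ∀ᶠ n in atTop, x ∈ K n := by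
  set K : ℕ → Set X := fun n => closedBall (0 : X) n ∩
    {x | ((n : ℝ≥0∞) + 1)⁻¹ ≤ Metric.infEDist x ((S : Set X)ᶜ)} with hK
  have hclosed : ∀ n, IsClosed (K n) := fun n =>
    isClosed_closedBall.inter (isClosed_le continuous_const Metric.continuous_infEDist)
  refine ⟨K, fun n => (isCompact_closedBall (0 : X) n).of_isClosed_subset (hclosed n)
    inter_subset_left, hclosed, fun n x hx => ?_, fun x hx => ?_⟩
  · -- `Kₙ ⊆ S`: positive distance to the closed set `Sᶜ`
    have hpos : 0 < Metric.infEDist x ((S : Set X)ᶜ) :=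
      lt_of_lt_of_le (ENNReal.inv_pos.2 (by simp)) hx.2
    have hx' : x ∉ closure ((S : Set X)ᶜ) := (Metric.infEDist_pos_iff_notMem_closure).1 hpos
    rw [S.isOpen.isClosed_compl.closure_eq] at hx'
    exact not_notMem.1 hx'
  · -- every `x ∈ S` is eventually in `Kₙ`
    have hx' : x ∉ closure ((S : Set X)ᶜ) := by
      rw [S.isOpen.isClosed_compl.closure_eq]; exact fun h => h hx
    have hpos : 0 < Metric.infEDist x ((S : Set X)ᶜ) :=
      (Metric.infEDist_pos_iff_notMem_closure).2 hx'
    have h1 : ∀ᶠ n : ℕ in atTop, ((n : ℝ≥0∞) + 1)⁻¹ ≤ Metric.infEDist x ((S : Set X)ᶜ) :=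
      (tendsto_inv_natCast_add_one.eventually (gt_mem_nhds hpos)).mono fun n hn => hn.le
    have h2 : ∀ᶠ n : ℕ in atTop, x ∈ closedBall (0 : X) n := by
      refine (tendsto_natCast_atTop_atTop.eventually_ge_atTop ‖x‖).mono fun n hn => ?_
      simpa using hn
    filter_upwards [h1, h2] with n hn1 hn2
    exact ⟨hn2, hn1⟩

variable [MeasurableSpace X] [BorelSpace X]
variable {F : Type*} [NormedAddCommGroup F] [NormedSpace ℝ F]

omit [NormedSpace ℝ F] in
/-- **Truncation to a compact subset in `L^p(S)`.** For `f ∈ L^p(S, μ)`, `p < ∞`, and `ε ≠ 0`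
there is a compact `K ⊆ S` with `‖f - 𝟙_K f‖_{L^p(S, μ)} ≤ ε` (dominated convergence along
the compact exhaustion of `S`). [folklore] -/
theorem exists_isCompact_eLpNorm_sub_indicator_le (S : Opens X) {μ : Measure X} {p : ℝ≥0∞}
    (hp : 1 ≤ p) (hp' : p ≠ ∞) {f : X → F} (hf : MemLp f p (μ.restrict S)) {ε : ℝ≥0∞}
    (hε : ε ≠ 0) :
    ∃ K : Set X, IsCompact K ∧ IsClosed K ∧ K ⊆ (S : Set X) ∧
      eLpNorm (f - K.indicator f) p (μ.restrict S) ≤ ε := by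
  obtain ⟨K, hKc, hKcl, hKS, hKev⟩ := exists_compact_exhaustion S
  have hp0 : p ≠ 0 := (lt_of_lt_of_le zero_lt_one hp).ne'
  have hpr : 0 < p.toReal := ENNReal.toReal_pos hp0 hp'
  set μS := μ.restrict (S : Set X) with hμS
  -- `∫⁻ 𝟙_{Kₙᶜ} ‖f‖ₑ^p → 0` by dominated convergence
  set g : ℕ → X → ℝ≥0∞ := fun n => (K n)ᶜ.indicator (fun x => ‖f x‖ₑ ^ p.toReal) with hg
  have hfm : AEStronglyMeasurable f μS := hf.aestronglyMeasurable
  have hbound : ∫⁻ x, ‖f x‖ₑ ^ p.toReal ∂μS ≠ ∞ :=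
    (lintegral_rpow_enorm_lt_top_of_eLpNorm_lt_top hp0 hp' hf.eLpNorm_lt_top).ne
  have hlim : Tendsto (fun n => ∫⁻ x, g n x ∂μS) atTop (𝓝 (∫⁻ x, (0 : ℝ≥0∞) ∂μS)) := by
    refine tendsto_lintegral_of_dominated_convergence' (fun x => ‖f x‖ₑ ^ p.toReal)
      (fun n => ?_) (fun n => Eventually.of_forall fun x => ?_) hbound ?_
    · exact (hfm.enorm.pow_const _).indicator (hKcl n).measurableSet.compl
    · exact indicator_le_self _ _ x
    · have : ∀ᵐ x ∂μS, x ∈ (S : Set X) := ae_restrict_mem S.isOpen.measurableSet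
      filter_upwards [this] with x hx
      refine tendsto_const_nhds.congr' ?_
      filter_upwards [hKev x hx] with n hn
      simp only [hg, indicator_of_notMem (Set.notMem_compl_iff.2 hn)]
  rw [lintegral_zero] at hlim
  -- hence `eLpNorm (𝟙_{Kₙᶜ} f) → 0`; pick `n` with value `≤ ε`
  have hlim' : Tendsto (fun n => eLpNorm ((K n)ᶜ.indicator f) p μS) atTop (𝓝 0) := by
    have h1 : ∀ n, eLpNorm ((K n)ᶜ.indicator f) p μS = (∫⁻ x, g n x ∂μS) ^ (1 / p.toReal) := by
      intro n
      rw [eLpNorm_eq_lintegral_rpow_enorm_toReal hp0 hp']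
      congr 1
      refine lintegral_congr fun x => ?_
      simp only [hg]
      rw [enorm_indicator_eq_indicator_enorm]
      by_cases hx : x ∈ (K n)ᶜ
      · rw [indicator_of_mem hx, indicator_of_mem hx]
      · rw [indicator_of_notMem hx, indicator_of_notMem hx, ENNReal.zero_rpow_of_pos hpr]
    simp_rw [h1]
    have := ((ENNReal.continuous_rpow_const (y := 1 / p.toReal)).tendsto 0).comp hlim
    rw [ENNReal.zero_rpow_of_pos (one_div_pos.2 hpr)] at this
    exact this
  obtain ⟨n, hn⟩ := ((tendsto_order.1 hlim').2 ε (pos_iff_ne_zero.2 hε)).exists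
  refine ⟨K n, hKc n, hKcl n, hKS n, ?_⟩
  rw [← indicator_compl (K n) f]
  exact hn.le

/-! ### Density of `C_c^∞(S)` in `L^p(S)` -/

/-- **Test functions on `S` are dense in `L^p(S)`** (Adams 1975, Cor. 2.19; Brezis, Cor. 4.23):
for `μ` finite on compact sets, `S` open, `1 ≤ p < ∞`, `f ∈ L^p(S, μ)` and `ε ≠ 0` there is a
test function `φ ∈ C_c^∞(S; F)` with `‖f - φ‖_{L^p(S, μ)} ≤ ε`. Proof: truncate `f` to a compact
`K ⊆ S` (`exists_isCompact_eLpNorm_sub_indicator_le`), approximate `𝟙_K f` in `L^p(X, μ)` by a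
smooth compactly supported `g` (Mathlib `MemLp.exist_eLpNorm_sub_le`), and put `φ = χ g` for a
smooth cut-off `χ ∈ C_c^∞(S)`, `0 ≤ χ ≤ 1`, `χ = 1` on `K`: then `𝟙_K f - χ g = χ (𝟙_K f - g)`
has smaller `L^p` norm than `𝟙_K f - g`. [cite: Brezis2011, Cor. 4.23] -/
theorem exists_isTestFunctionOn_eLpNorm_sub_le (S : Opens X) {μ : Measure X}
    [IsFiniteMeasureOnCompacts μ] {p : ℝ≥0∞} (hp : 1 ≤ p) (hp' : p ≠ ∞) {f : X → F}
    (hf : MemLp f p (μ.restrict S)) {ε : ℝ≥0∞} (hε : ε ≠ 0) :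
    ∃ φ : X → F, IsTestFunctionOn S φ ∧ eLpNorm (f - φ) p (μ.restrict S) ≤ ε := by
  rcases eq_or_ne ε ∞ with rfl | hεtop
  · exact ⟨0, isTestFunctionOn_zero S, le_top⟩
  have hε2 : ε / 2 ≠ 0 := (ENNReal.half_pos hε).ne'
  have hε2top : ε / 2 ≠ ∞ := ENNReal.div_ne_top hεtop (by simp)
  set μS := μ.restrict (S : Set X) with hμS
  have hSm : MeasurableSet (S : Set X) := S.isOpen.measurableSet
  -- Step 1: truncation
  obtain ⟨K, hKc, hKcl, hKS, hK⟩ := exists_isCompact_eLpNorm_sub_indicator_le S hp hp' hf hε2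
  -- Step 2: `𝟙_K f ∈ L^p(X, μ)` and its smooth approximation on the whole space
  set G : X → F := K.indicator f with hG
  have hGS : G = K.indicator ((S : Set X).indicator f) := by
    rw [hG, indicator_indicator, inter_eq_left.2 hKS]
  have hGp : MemLp G p μ := by
    rw [hGS]
    exact ((memLp_indicator_iff_restrict hSm).2 hf).indicator hKcl.measurableSet
  have hδ : 0 < (ε / 2).toReal := ENNReal.toReal_pos hε2 hε2top
  obtain ⟨g, hgc, hgs, hg⟩ := hGp.exist_eLpNorm_sub_le hp' hp hδ
  rw [ENNReal.ofReal_toReal hε2top] at hg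
  -- Step 3: cut-off
  obtain ⟨χ, hχs, hχc, hχS, hχK, hχ01⟩ := exists_smooth_cutoff_mem_Icc hKc S.isOpen hKS
  set φ : X → F := fun x => χ x • g x with hφ
  have hφtest : IsTestFunctionOn S φ :=
    { contDiff := hχs.smul hgs
      hasCompactSupport := hgc.smul_left
      tsupport_subset := (tsupport_smul_subset_left χ g).trans hχS }
  refine ⟨φ, hφtest, ?_⟩
  -- Step 4: `‖G - φ‖_p ≤ ‖G - g‖_p ≤ ε/2`
  have hGφ : eLpNorm (G - φ) p μ ≤ ε / 2 := by
    have hpt : ∀ x, ‖(G - φ) x‖ ≤ ‖(G - g) x‖ := by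
      intro x
      have e : (G - φ) x = χ x • (G - g) x := by
        simp only [Pi.sub_apply, hφ, smul_sub]
        congr 1
        by_cases hx : x ∈ K
        · rw [hχK x hx, one_smul]
        · rw [hG, indicator_of_notMem hx, smul_zero]
      rw [e, norm_smul]
      have h01 := hχ01 x
      calc ‖χ x‖ * ‖(G - g) x‖ ≤ 1 * ‖(G - g) x‖ := by
            gcongr
            rw [Real.norm_eq_abs, abs_le]
            exact ⟨by linarith [h01.1], h01.2⟩
        _ = ‖(G - g) x‖ := one_mul _
    exact (eLpNorm_mono hpt).trans hg
  -- Step 5: triangle inequality on `S`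
  have h1 : eLpNorm (G - φ) p μS ≤ ε / 2 :=
    (eLpNorm_mono_measure _ Measure.restrict_le_self).trans hGφ
  have hGm : AEStronglyMeasurable G μS := hGp.aestronglyMeasurable.mono_measure Measure.restrict_le_self
  have hφm : AEStronglyMeasurable φ μS :=
    (hφtest.contDiff.continuous.aestronglyMeasurable).mono_measure Measure.restrict_le_self
  have e : f - φ = (f - G) + (G - φ) := by abel
  calc eLpNorm (f - φ) p μS = eLpNorm ((f - G) + (G - φ)) p μS := by rw [e]
    _ ≤ eLpNorm (f - G) p μS + eLpNorm (G - φ) p μS :=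
        eLpNorm_add_le (hf.aestronglyMeasurable.sub hGm) (hGm.sub hφm) hp
    _ ≤ ε / 2 + ε / 2 := add_le_add hK h1
    _ = ε := ENNReal.add_halves ε

/-- **Test functions on `S` are dense in `L^p(S)`**, sequential form: for `f ∈ L^p(S, μ)`,
`1 ≤ p < ∞`, there are `φₙ ∈ C_c^∞(S; F)` with `‖f - φₙ‖_{L^p(S, μ)} → 0` (Adams 1975,
Cor. 2.19; Brezis, Cor. 4.23). [cite: Brezis2011, Cor. 4.23] -/
theorem exists_isTestFunctionOn_tendsto_eLpNorm_sub (S : Opens X) {μ : Measure X}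
    [IsFiniteMeasureOnCompacts μ] {p : ℝ≥0∞} (hp : 1 ≤ p) (hp' : p ≠ ∞) {f : X → F}
    (hf : MemLp f p (μ.restrict S)) :
    ∃ φ : ℕ → X → F, (∀ n, IsTestFunctionOn S (φ n)) ∧
      Tendsto (fun n => eLpNorm (f - φ n) p (μ.restrict S)) atTop (𝓝 0) := by
  have hpos : ∀ n : ℕ, ((n : ℝ≥0∞) + 1)⁻¹ ≠ 0 := fun n => by simp
  choose φ hφ hφε using fun n : ℕ => exists_isTestFunctionOn_eLpNorm_sub_le S hp hp' hf (hpos n)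
  refine ⟨φ, hφ, ?_⟩
  exact tendsto_of_tendsto_of_tendsto_of_le_of_le tendsto_const_nhds tendsto_inv_natCast_add_one
    (fun _ => bot_le) hφε

end Literature.Analysis.FunctionSpaces
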